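import Literature.MathematicalPhysics.QuantumFieldTheory.Balaban1983to89.B8Prop6CubeMemberRealOfGBound

/-!
# `Balaban1983to89.B8Thm32GBoundCubeMember` — [Balaban1985BackgroundPropagators] THEOREM 3.2 (3.48) at `U = 1` on the cube member, NAMED: the 𝒢-bound
# `GBoundCubeMemberPrinted d ℓ : Prop` (the ONE open real estimate of N05's p6 flat road) and the p6 consumer's three real families CONDITIONAL on it

statement-level skeleton of published theorems with citation tags; proofs where landed; nothing here is a claim about the
Yang–Mills mass gap

`[Balaban1985BackgroundPropagators]` ("[4]", CMP **99** (1985) 389–434) Theorem 3.2 (3.48) p. 398 («Under the assumptions of Theorem 3.1, and with the same constants,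
|(Q′(U)G′²(U)Q′*(U))⁻¹(y,y′)| ≦ B₀ … e^{−δd(y,y′)}»), proved there (p. 399 ff.) by the random-walk expansion of [Balaban1984PropagatorsII] Prop. 2.3;
`[Balaban1985RegularSpaces]` ("B8") (1.91)–(1.92) p. 91, p. 92 («from Theorems 3.1, 3.2 of [4] it follows …»), p. 98.

CITATION HEADER (lean-in-tree rule).  Cell `pub-ymgap` (YM Track A, HUMAN RULING D-0062), DAG node N05 = [B8], seat `pub-ymgap-dag-n05-c` (g9; (R1′) programme, file F10).
NAMED FACT per the prover rules («an unproved published result is a Literature `def X : Prop`; taking `(hX : X)` makes a theorem CONDITIONAL»): after F1–F9 the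
real side of n05-e's p6 flat consumer `B8Prop6CubeMemberFlatScalar.prop6_cubeMember_flat_of_real` rests on ONE published estimate not yet in the tree — [4]
Theorem 3.2 for the glued Dirichlet operator of the cube member at `U = 1`, row-summed, in the consumer's normalisation.  THIS FILE names it (`GBoundCubeMemberPrinted`,
exactly the hypothesis `hG` of `B8Prop6CubeMemberRealOfGBound.prop6_real123_of_gbound_printed` with its constant and data thresholds existentially bound) and
states the consumer's three real families CONDITIONAL on it.  A proof (`theorem GBoundCubeMemberPrinted_holds`) is the successor programme
(`HOME/pub-ymgap-dag-n05-c/R23-DESIGN.md` §UPDATE: tower dictionary to p21's `B6Prop23MultiLevelBox.prop23_multiLevelBox`, kernel decay of the glued `T⁻¹`,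
tower parametrix; first brick `B8Eq348CubeMemberTowerGramAlgebra` landed).

WHAT THIS FILE DECLARES ∕ PROVES.
* `GBoundCubeMemberPrinted (d ℓ : ℕ) : Prop` — ∃ `C_𝒢 ≥ 0`, `ρ₀, M₀, N₀`: on print's big-block sub-lattice of cube data (as in F4e∕F7∕F8), for the consumer's `S, B, K`
  (at `wPrinted`), `T, Q`: `sup|X| ≤ s ⟹ wt(j_p)⁴·L^{−(d+1)j_p}·|((QT⁻¹T⁻¹Qᵀ)⁻¹X)_p| ≤ C_𝒢·s`.  A `def`, NOT an axiom; nothing consumes it silently.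
* ★ `prop6_real123_printed_of_GBound (hG : GBoundCubeMemberPrinted d ℓ)` — ∃ `B_G, B₀′_H > 0`, `B₂′, B_R ≥ 0`, thresholds: REAL-1 ∧ REAL-2 ∧ REAL-3 of the consumer
  verbatim at `wPrinted` (F8 with the hypothesis named; `B₀′_H` enlarged by `B_G` to be positive).  CONDITIONAL (the gate records a conditional result).

HONEST SCOPE ∕ NOT CLAIMED.  `GBoundCubeMemberPrinted` is OPEN here — a named published estimate, not a result of this file, and NOT the seat's own target (the
seat supports K1⁷ `stmt-QuantumFields-20542` only through N05's p6 road).  Count-neutral; N05 NOT discharged; one finite `T⁴` programme at fixed `ε`, Bałaban as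
printed; nothing continuum ∕ ℝ⁴ ∕ OS ∕ mass-gap ∕ Clay.  No `sorry`, no `instance`, no `notation`; one `def` (a `Prop`).  Unit `pub-ymgap-dag-n05-c` (g9), 2026-08-27.

RELATED IN THE TREE, NOT DUPLICATED: `B8Prop6CubeMemberRealOfGBound.prop6_real123_of_gbound_printed` (F8, USED: the unconditional form with `hG` displayed per datum),
`B8Eq192CubeMemberOfReal1G.real2_of_real1_gbound` (F6), `B6Prop23MultiLevelBox.prop23_multiLevelBox` (p21: [B6] Prop. 2.3 on the Neumann box — the deep local
inverse of the future proof), `B8Thm4ConcreteBdryBeta` ∕ `B8Prop6CubeMemberFlatScalar` (n05-e consumers).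
-/
noncomputable section

namespace Literature.MathematicalPhysics.QuantumFieldTheory.Balaban1983to89.B8Thm32GBoundCubeMember

open scoped Matrix
open B7Prop1Explicit (e)
open B8Eq131CubesAdmissible (cubeFam)
open B8Eq140Level (SideTouches)
open B8CubeMemberZd (cubeLamS)
open B8LambdaSpaceKLevel (wt)
open B8Eq1101CubeMemberWeights (wPrinted)
open B8Prop6CubeMemberRealOfGBound (prop6_real123_of_gbound_printed)
open Literature.MathematicalPhysics.QuantumLattice (blockMap)

open Classical in
/-- **[Balaban1985BackgroundPropagators] THEOREM 3.2 (3.48) AT `U = 1` ON THE CUBE MEMBER, ROW-SUMMED, IN THE CONSUMER'S NORMALISATION — THE 𝒢-BOUND**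
(«Under the assumptions of Theorem 3.1, and with the same constants, the following inequality holds: |(Q′(U)G′²(U)Q′*(U))⁻¹(y,y′)| ≦ B₀(Lʲη)^{…}(L^{j′}η)^{…}e^{−δd(y,y′)},
y ∈ Λ_j, y′ ∈ Λ_{j′}», summed over `y′` with [B6] Lemma 2.1).  For the explicit matrices of `B8Prop6CubeMemberFlatScalar.prop6_cubeMember_flat_of_real` at the printed
weights `wPrinted` (`L = ℓ + 1`, dimension `d + 1`): there are `C_𝒢 ≥ 0`, thresholds `ρ₀, M₀` and `N₀` such that on print's big-block sub-lattice of cube data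
(`M_h ≥ 3`, `M₀ ≤ L·M_h`, `M_hL ∣ ρ`, `M_hL ∣ M`, `R·M_hL ≤ ρ`, `2L ≤ R`, `N₀ + 1 ≤ R·L·M_h`, `ρ₀ ≤ ρ`; truncation `1 ≤ n ≤ k`) the operator `𝒢 = (QT⁻¹T⁻¹Qᵀ)⁻¹`
satisfies `wt(j_p)⁴·L^{−(d+1)j_p}·|(𝒢X)_p| ≤ C_𝒢·sup|X|` for every `X` on the towers.  OPEN in the tree (the one remaining real estimate of the p6 flat road;
design `HOME/pub-ymgap-dag-n05-c/R23-DESIGN.md`); print proves it by the random-walk expansion of [B6] Prop. 2.3.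
[cite: Balaban1985BackgroundPropagators, Theorem 3.2 (3.48) p.398, Theorem 3.1 (3.47) p.398; Balaban1985RegularSpaces, (1.91)–(1.92) p.91, p.98; Balaban1984PropagatorsII, Prop. 2.3 (2.87) p.238, Lemma 2.1 (2.61) p.234] -/
def GBoundCubeMemberPrinted (d ℓ : ℕ) : Prop :=
  ∃ CG ρ₀ M₀ : ℝ, ∃ N₀ : ℕ, 0 ≤ CG ∧
    ∀ (η : ℝ), 0 < η → ∀ (Mh : ℕ), 3 ≤ Mh → M₀ ≤ ((ℓ : ℝ) + 1) * Mh →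
    ∀ (a : Fin (d + 1) → ℤ) (M ρ k n R : ℕ), 1 ≤ n → n ≤ k → Mh * (ℓ + 1) ∣ ρ → Mh * (ℓ + 1) ∣ M → 0 < ρ →
      R * (Mh * (ℓ + 1)) ≤ ρ → 2 * (ℓ + 1) ≤ R → N₀ + 1 ≤ R * ((ℓ + 1) * Mh) → ρ₀ ≤ (ρ : ℝ) →
    ∀ (S : Finset (Fin (d + 1) → ℤ)), (∀ z, z ∈ S ↔ z ∈ cubeFam false (ℓ + 1) a M ρ k 0) →
    ∀ (B : Finset (ℕ × (Fin (d + 1) → ℤ))), (∀ p, p ∈ B ↔ p.1 ≤ n ∧ p.2 ∈ cubeLamS (ℓ + 1) a M ρ k n p.1) →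
    ∀ (K : (Fin (d + 1) → ℤ) → (Fin (d + 1) → ℤ) → ℝ), (∀ x z, K x z =
        ((η ^ 2)⁻¹ * ∑ μ : Fin (d + 1), ((2 : ℝ) * (if z = x then (1 : ℝ) else 0) - (if z = x + e μ then (1 : ℝ) else 0)
          - (if z = x - e μ then (1 : ℝ) else 0))) +
        (∑ j ∈ Finset.range (n + 1), (if blockMap ((ℓ + 1) ^ j) x ∈ cubeLamS (ℓ + 1) a M ρ k n j ∧
            blockMap ((ℓ + 1) ^ j) z = blockMap ((ℓ + 1) ^ j) x then
          wPrinted d ℓ η j * (((((ℓ + 1 : ℕ) : ℝ) ^ (d + 1))⁻¹) ^ j) ^ 2 else 0))) →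
    ∀ (T : Matrix ↥S ↥S ℝ), T = Matrix.of (fun x z : ↥S => K x.1 z.1) →
    ∀ (Q : Matrix ↥B ↥S ℝ), Q = Matrix.of (fun (p : ↥B) (z : ↥S) =>
        if blockMap ((ℓ + 1) ^ p.1.1) z.1 = p.1.2 then (((((ℓ + 1 : ℕ) : ℝ)) ^ (d + 1))⁻¹) ^ p.1.1 else 0) →
    ∀ (X : ↥B → ℝ) (s : ℝ), 0 ≤ s → (∀ p', |X p'| ≤ s) → ∀ p : ↥B,
      wt (ℓ + 1) η p.1.1 ^ 4 * (((((ℓ + 1 : ℕ) : ℝ)) ^ (d + 1)) ^ p.1.1)⁻¹ * |∑ p' : ↥B, (Q * T⁻¹ * T⁻¹ * Qᵀ)⁻¹ p p' * X p'| ≤ CG * s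

open Classical in
/-- **THE p6 FLAT CONSUMER'S THREE REAL FAMILIES FROM THE NAMED 𝒢-BOUND** (`GBoundCubeMemberPrinted d ℓ`): REAL-1 ((1.101)), REAL-2 ((1.92) + Δ-entry) and REAL-3
((1.98)) of `B8Prop6CubeMemberFlatScalar.prop6_cubeMember_flat_of_real`, in its verbatim shapes at `w = wPrinted`, on print's big-block sub-lattice (thresholds merged),
with constants `B_G, B₀′_H > 0`, `B₂′, B_R ≥ 0` depending on `d, ℓ` only.  (`B8Prop6CubeMemberRealOfGBound.prop6_real123_of_gbound_printed` with the hypothesis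
named; CONDITIONAL on the open `GBoundCubeMemberPrinted`.)
[cite: Balaban1985RegularSpaces, (1.91)–(1.92) p.91, (1.98) p.92, (1.101) p.93, p.98; Balaban1985BackgroundPropagators, Theorems 3.1–3.2 (3.47)–(3.48) p.398] -/
theorem prop6_real123_printed_of_GBound (d ℓ : ℕ) (hℓ : 1 ≤ ℓ) (hG : GBoundCubeMemberPrinted d ℓ) :
    ∃ BG B₀'H B₂' BR ρ₀ M₀ : ℝ, ∃ N₀ : ℕ, 0 < BG ∧ 0 < B₀'H ∧ 0 ≤ B₂' ∧ 0 ≤ BR ∧ 0 < M₀ ∧ 0 < N₀ ∧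
      ∀ (η : ℝ), 0 < η → ∀ (Mh : ℕ), 3 ≤ Mh → M₀ ≤ ((ℓ : ℝ) + 1) * Mh →
      ∀ (a : Fin (d + 1) → ℤ) (M ρ k n R : ℕ), 1 ≤ n → n ≤ k → Mh * (ℓ + 1) ∣ ρ → Mh * (ℓ + 1) ∣ M → 0 < ρ →
        R * (Mh * (ℓ + 1)) ≤ ρ → 2 * (ℓ + 1) ≤ R → N₀ + 1 ≤ R * ((ℓ + 1) * Mh) → ρ₀ ≤ (ρ : ℝ) →
      ∀ (S : Finset (Fin (d + 1) → ℤ)), (∀ z, z ∈ S ↔ z ∈ cubeFam false (ℓ + 1) a M ρ k 0) →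
      ∀ (B : Finset (ℕ × (Fin (d + 1) → ℤ))), (∀ p, p ∈ B ↔ p.1 ≤ n ∧ p.2 ∈ cubeLamS (ℓ + 1) a M ρ k n p.1) →
      ∀ (K : (Fin (d + 1) → ℤ) → (Fin (d + 1) → ℤ) → ℝ), (∀ x z, K x z =
          ((η ^ 2)⁻¹ * ∑ μ : Fin (d + 1), ((2 : ℝ) * (if z = x then (1 : ℝ) else 0) - (if z = x + e μ then (1 : ℝ) else 0)
            - (if z = x - e μ then (1 : ℝ) else 0))) +
          (∑ j ∈ Finset.range (n + 1), (if blockMap ((ℓ + 1) ^ j) x ∈ cubeLamS (ℓ + 1) a M ρ k n j ∧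
              blockMap ((ℓ + 1) ^ j) z = blockMap ((ℓ + 1) ^ j) x then
            wPrinted d ℓ η j * (((((ℓ + 1 : ℕ) : ℝ) ^ (d + 1))⁻¹) ^ j) ^ 2 else 0))) →
      ∀ (T : Matrix ↥S ↥S ℝ), T = Matrix.of (fun x z : ↥S => K x.1 z.1) →
      ∀ (Q : Matrix ↥B ↥S ℝ), Q = Matrix.of (fun (p : ↥B) (z : ↥S) =>
          if blockMap ((ℓ + 1) ^ p.1.1) z.1 = p.1.2 then (((((ℓ + 1 : ℕ) : ℝ)) ^ (d + 1))⁻¹) ^ p.1.1 else 0) →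
      -- REAL-1
      (∀ (ρ' : ↥S → ℝ) (r : ℝ), 0 ≤ r →
        (∀ j, j ≤ n → ∀ z : ↥S, z.1 ∈ cubeFam false (ℓ + 1) a M ρ k j → wt (ℓ + 1) η j ^ 2 * |ρ' z| ≤ r) →
        ∀ φ : (Fin (d + 1) → ℤ) → ℝ, (∀ x, x ∉ cubeFam false (ℓ + 1) a M ρ k 0 → φ x = 0) →
          (∀ v : ↥S, φ v.1 = ∑ z : ↥S, T⁻¹ v z * ρ' z) →
          (∀ x, |φ x| ≤ BG * r) ∧
          ∀ j, j ≤ n → ∀ p ∈ {b : (Fin (d + 1) → ℤ) × Fin (d + 1) | SideTouches (cubeFam false (ℓ + 1) a M ρ k j) b.1 b.2},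
            wt (ℓ + 1) η j * |η⁻¹ * (φ (p.1 + e p.2) - φ p.1)| ≤ BG * r) ∧
      -- REAL-2
      (∀ (X : ↥B → ℝ) (s : ℝ), 0 ≤ s → (∀ p', |X p'| ≤ s) →
        ∀ φ : (Fin (d + 1) → ℤ) → ℝ, (∀ x, x ∉ cubeFam false (ℓ + 1) a M ρ k 0 → φ x = 0) →
          (∀ v : ↥S, φ v.1 = ∑ p' : ↥B, (T⁻¹ * (T⁻¹ * Qᵀ) * (Q * T⁻¹ * T⁻¹ * Qᵀ)⁻¹) v p' * X p') →
          (∀ x, |φ x| ≤ B₀'H * s) ∧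
          (∀ j, j ≤ n → ∀ p ∈ {b : (Fin (d + 1) → ℤ) × Fin (d + 1) | SideTouches (cubeFam false (ℓ + 1) a M ρ k j) b.1 b.2},
            wt (ℓ + 1) η j * |η⁻¹ * (φ (p.1 + e p.2) - φ p.1)| ≤ B₀'H * s) ∧
          (∀ j, j ≤ n → ∀ x ∈ cubeFam false (ℓ + 1) a M ρ k j,
            wt (ℓ + 1) η j ^ 2 * |∑ μ : Fin (d + 1), (η ^ 2)⁻¹ * (2 * φ x - φ (x + e μ) - φ (x - e μ))| ≤ B₂' * s)) ∧
      -- REAL-3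
      (∀ (ρ' : ↥S → ℝ) (r : ℝ), 0 ≤ r →
        (∀ j, j ≤ n → ∀ z : ↥S, z.1 ∈ cubeFam false (ℓ + 1) a M ρ k j → wt (ℓ + 1) η j ^ 2 * |ρ' z| ≤ r) →
        ∀ j, j ≤ n → ∀ v : ↥S, v.1 ∈ cubeFam false (ℓ + 1) a M ρ k j →
          wt (ℓ + 1) η j ^ 2 * |ρ' v - ∑ z : ↥S, (T⁻¹ * (Qᵀ * ((Q * T⁻¹ * T⁻¹ * Qᵀ)⁻¹ * (Q * T⁻¹)))) v z * ρ' z| ≤ BR * r) := by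
  obtain ⟨CG, ρG, MG, NG, hCG, hGb⟩ := hG
  obtain ⟨BG, BG', ρ₁, M₁, N₁, hBG, hBG', hM₁, hN₁, h⟩ := prop6_real123_of_gbound_printed d ℓ hℓ
  refine ⟨BG, BG * (BG' * CG) + BG, BG' * CG + 8, 1 + ((BG' * CG + 8) + 8) * BG, max ρ₁ ρG, max M₁ MG, max N₁ NG, hBG, by positivity,
    by positivity, by positivity, lt_max_of_lt_left hM₁, lt_max_of_lt_left hN₁, ?_⟩
  intro η hη Mh hMh hM0 a M ρ k n R hn hnk hρd hMd hρ0 hR hR2 hRN hρbig S hS B hB K hK T hT Q hQ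
  have hM01 : M₁ ≤ ((ℓ : ℝ) + 1) * Mh := (le_max_left _ _).trans hM0
  have hM02 : MG ≤ ((ℓ : ℝ) + 1) * Mh := (le_max_right _ _).trans hM0
  have hRN1 : N₁ + 1 ≤ R * ((ℓ + 1) * Mh) := le_trans (Nat.add_le_add_right (le_max_left _ _) 1) hRN
  have hRN2 : NG + 1 ≤ R * ((ℓ + 1) * Mh) := le_trans (Nat.add_le_add_right (le_max_right _ _) 1) hRN
  have hρ1 : ρ₁ ≤ (ρ : ℝ) := (le_max_left _ _).trans hρbig
  have hρ2 : ρG ≤ (ρ : ℝ) := (le_max_right _ _).trans hρbig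
  have hGdata := hGb η hη Mh hMh hM02 a M ρ k n R hn hnk hρd hMd hρ0 hR hR2 hRN2 hρ2 S hS B hB K hK T hT Q hQ
  obtain ⟨h1, h2, h3⟩ := h η hη Mh hMh hM01 a M ρ k n R hn hnk hρd hMd hρ0 hR hR2 hRN1 hρ1 S hS B hB K hK T hT Q hQ CG hCG hGdata
  refine ⟨h1, fun X s hs hXs φ hφ0 hφS => ?_, h3⟩
  obtain ⟨hf, hg, hΔ⟩ := h2 X s hs hXs φ hφ0 hφS
  have hmono : BG * (BG' * CG) * s ≤ (BG * (BG' * CG) + BG) * s := by nlinarith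
  exact ⟨fun x => (hf x).trans hmono, fun j hj p hp => (hg j hj p hp).trans hmono, hΔ⟩

end Literature.MathematicalPhysics.QuantumFieldTheory.Balaban1983to89.B8Thm32GBoundCubeMember
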